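import Summits.CriticalPhenomena.PercolationContinuityZ3.Theorems.PercNearOneGluingNoHeavyLowerTailSahiOneStepThresholdStep
import HarnessLib

/-!
# One-step scheme, `(2′)` half: the SHARP density-free pivot criterion (`M₂ ≥ −2√(n¹·n⁰)`)

Support file (prover prim-ineq-prove-3 gen 35; `--supports stmt-CriticalPhenomena-4575`; memo
`run/shared/lean/prim/prim-ineq-prove-3/FINDING-G35-PIVOT-SQRT.md` §1).  No definitions, no named facts, no sorries, no `native_decide`.

Setting (`…SahiOneStepCone`, `…SahiOneStepThresholdStep`): `μ = prodBernoulli p`, first slot `H`, `n = osN p H (ind A) (ind B)`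
(`n ≥ 0 ⟺ Cov(A,B) ≥ μ(Hᶜ)·Cov(A,B ∣ Hᶜ)`), sections `X¹ = {ω | insert e ω ∈ X}`, `X⁰ = {ω | ω ∖ {e} ∈ X}` at a coordinate `e`,
`n¹ = n(H¹;A¹,B¹)`, `n⁰ = n(H⁰;A⁰,B⁰)`, and the step forms `M₂`, `M₁ = M₂ + X` (`X = (μH¹−μH⁰)(μA¹−μA⁰)(μB¹−μB⁰)`) of the pivot identity
`osN_ind_ind_pivot_eq`: `n = p²n¹ + q²n⁰ + pq(p·M₂ + q·M₁)` (`p = p_e`, `q = 1 − p`).  Since `p + q = 1` this is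
`n = (p√n¹ − q√n⁰)² + pq·[M₂ + 2√n¹√n⁰] + pq²·X`, so:

* `osN_ind_ind_nonneg_of_sqrtStep` — `n¹ ≥ 0`, `n⁰ ≥ 0`, monotone sections and the SQRT-STEP inequality `M₂ + 2·√n¹·√n⁰ ≥ 0` give `n ≥ 0`.
  This weakens the hypothesis `M₂ ≥ 0` of `osN_ind_ind_nonneg_of_step` (gen 19) to the sharp density-free one: if conversely
  `M₂ + 2√n¹√n⁰ + q*·X < 0` with `q* = √n¹/(√n¹+√n⁰)`, then `n < 0` at the density `p_e = 1 − q*` (memo §1; not formalised here).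
* `osN_threshold_nonneg_of_sqrtStep` — induction on the block: if the sqrt-step inequality holds for every threshold slot, every counted
  coordinate and every pair of increasing events determined by the block, then `n ≥ 0` for EVERY threshold slot `{ω | t ≤ #(F ∩ ω)}`;
* `sahiE3_threshold_nonneg_of_sqrtStep` — with the unconditional `(3′)` half (`osMp_threshold_nonneg`), Kahn C5 / Sahi `C₃ ≥ 0` for every
  threshold first slot and ALL increasing `A, B`, conditional only on the sqrt-step inequality.
-/

noncomputable section

namespace Summit.CriticalPhenomena.PercolationContinuityZ3.Theorems

namespace SahiOneStep

open MeasureTheory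
open Literature.Probability.Percolation (DeterminedBy determinedBy_iff)
open Literature.Probability.LatticeModels (prodBernoulli sahiE3)
open Literature.Probability.Percolation.DecisionTree (ind)
open SahiE3Sections (determinedBy_section_insert determinedBy_section_sdiff)
open scoped Classical

variable {ι : Type*} [Fintype ι]

/-! ## The sqrt-step criterion at one coordinate -/

/-- **SHARP DENSITY-FREE PIVOT CRITERION for `(2′)`.**  If the two section values `n¹ = n(H¹;A¹,B¹)`, `n⁰ = n(H⁰;A⁰,B⁰)` are nonnegative,
the sections are monotone (`μH⁰ ≤ μH¹`, `μA⁰ ≤ μA¹`, `μB⁰ ≤ μB¹`, automatic for increasing `H, A, B`) and the step form satisfies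
`0 ≤ M₂ + 2·√n¹·√n⁰`, then `n(H;A,B) ≥ 0` — because `n = (p√n¹ − q√n⁰)² + pq·(M₂ + 2√n¹√n⁰) + pq²·X`. [this work] -/
theorem osN_ind_ind_nonneg_of_sqrtStep (p : ι → unitInterval) (H A B : Set (Set ι)) (e : ι)
    (h1 : 0 ≤ osN p {ω : Set ι | insert e ω ∈ H} (ind {ω : Set ι | insert e ω ∈ A}) (ind {ω : Set ι | insert e ω ∈ B}))
    (h0 : 0 ≤ osN p {ω : Set ι | ω \ {e} ∈ H} (ind {ω : Set ι | ω \ {e} ∈ A}) (ind {ω : Set ι | ω \ {e} ∈ B}))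
    (hM2 : 0 ≤
      ((prodBernoulli p).real {ω : Set ι | ω \ {e} ∈ A} - (prodBernoulli p).real ({ω : Set ι | ω \ {e} ∈ H} ∩ {ω : Set ι | ω \ {e} ∈ A})) *
          ((prodBernoulli p).real {ω : Set ι | insert e ω ∈ B} - (prodBernoulli p).real ({ω : Set ι | insert e ω ∈ H} ∩ {ω : Set ι | insert e ω ∈ B}))
        + ((prodBernoulli p).real {ω : Set ι | insert e ω ∈ A} - (prodBernoulli p).real ({ω : Set ι | insert e ω ∈ H} ∩ {ω : Set ι | insert e ω ∈ A})) *
          ((prodBernoulli p).real {ω : Set ι | ω \ {e} ∈ B} - (prodBernoulli p).real ({ω : Set ι | ω \ {e} ∈ H} ∩ {ω : Set ι | ω \ {e} ∈ B}))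
        + (1 - (prodBernoulli p).real {ω : Set ι | ω \ {e} ∈ H}) *
          (prodBernoulli p).real ({ω : Set ι | insert e ω ∈ H} ∩ {ω : Set ι | insert e ω ∈ A} ∩ {ω : Set ι | insert e ω ∈ B})
        + (1 - (prodBernoulli p).real {ω : Set ι | insert e ω ∈ H}) *
          (prodBernoulli p).real ({ω : Set ι | ω \ {e} ∈ H} ∩ {ω : Set ι | ω \ {e} ∈ A} ∩ {ω : Set ι | ω \ {e} ∈ B})
        - ((prodBernoulli p).real {ω : Set ι | insert e ω ∈ H} - (prodBernoulli p).real {ω : Set ι | ω \ {e} ∈ H}) *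
          (prodBernoulli p).real {ω : Set ι | insert e ω ∈ A} * (prodBernoulli p).real {ω : Set ι | insert e ω ∈ B}
        - (1 - (prodBernoulli p).real {ω : Set ι | insert e ω ∈ H}) *
          ((prodBernoulli p).real {ω : Set ι | insert e ω ∈ A} * (prodBernoulli p).real {ω : Set ι | ω \ {e} ∈ B}
            + (prodBernoulli p).real {ω : Set ι | ω \ {e} ∈ A} * (prodBernoulli p).real {ω : Set ι | insert e ω ∈ B})
        + 2 * (Real.sqrt (osN p {ω : Set ι | insert e ω ∈ H} (ind {ω : Set ι | insert e ω ∈ A}) (ind {ω : Set ι | insert e ω ∈ B})) *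
            Real.sqrt (osN p {ω : Set ι | ω \ {e} ∈ H} (ind {ω : Set ι | ω \ {e} ∈ A}) (ind {ω : Set ι | ω \ {e} ∈ B}))))
    (hH : (prodBernoulli p).real {ω : Set ι | ω \ {e} ∈ H} ≤ (prodBernoulli p).real {ω : Set ι | insert e ω ∈ H})
    (hA : (prodBernoulli p).real {ω : Set ι | ω \ {e} ∈ A} ≤ (prodBernoulli p).real {ω : Set ι | insert e ω ∈ A})
    (hB : (prodBernoulli p).real {ω : Set ι | ω \ {e} ∈ B} ≤ (prodBernoulli p).real {ω : Set ι | insert e ω ∈ B}) :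
    0 ≤ osN p H (ind A) (ind B) := by
  rw [osN_ind_ind_pivot_eq p H A B e]
  set n1 := osN p {ω : Set ι | insert e ω ∈ H} (ind {ω : Set ι | insert e ω ∈ A}) (ind {ω : Set ι | insert e ω ∈ B}) with hn1
  set n0 := osN p {ω : Set ι | ω \ {e} ∈ H} (ind {ω : Set ι | ω \ {e} ∈ A}) (ind {ω : Set ι | ω \ {e} ∈ B}) with hn0
  set s1 := Real.sqrt n1 with hs1
  set s0 := Real.sqrt n0 with hs0
  have hp0 : 0 ≤ (p e : ℝ) := (p e).2.1
  have hq0 : 0 ≤ 1 - (p e : ℝ) := sub_nonneg.2 (p e).2.2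
  have hX : 0 ≤ ((prodBernoulli p).real {ω : Set ι | insert e ω ∈ H} - (prodBernoulli p).real {ω : Set ι | ω \ {e} ∈ H}) *
      ((prodBernoulli p).real {ω : Set ι | insert e ω ∈ A} - (prodBernoulli p).real {ω : Set ι | ω \ {e} ∈ A}) *
      ((prodBernoulli p).real {ω : Set ι | insert e ω ∈ B} - (prodBernoulli p).real {ω : Set ι | ω \ {e} ∈ B}) :=
    mul_nonneg (mul_nonneg (sub_nonneg.2 hH) (sub_nonneg.2 hA)) (sub_nonneg.2 hB)
  have e1 : s1 * s1 = n1 := Real.mul_self_sqrt h1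
  have e0 : s0 * s0 = n0 := Real.mul_self_sqrt h0
  have hsq : 0 ≤ ((p e : ℝ) * s1 - (1 - p e) * s0) ^ 2 := sq_nonneg _
  have tM := mul_nonneg (mul_nonneg hp0 hq0) hM2
  have tX := mul_nonneg (mul_nonneg (mul_nonneg hp0 hq0) hq0) hX
  nlinarith [hsq, e1, e0, tM, tX]

/-! ## The reduction: the sqrt-step inequality implies `(2′)` for every threshold slot -/

/-- **REDUCTION OF `(2′)` FOR ALL THRESHOLD SLOTS TO THE SQRT-STEP INEQUALITY.**  Suppose that for every block `F`, every `e ∉ F`, every `t`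
and all increasing `A, B` determined by `insert e F`, the step form `M₂` of `osN_ind_ind_pivot_eq` for the slot
`H = {ω | t+1 ≤ #(insert e F ∩ ω)}` at `e` satisfies `0 ≤ M₂ + 2·√n(H¹;A¹,B¹)·√n(H⁰;A⁰,B⁰)`.  Then `n(H;A,B) ≥ 0` for EVERY threshold slot
`H = {ω | t ≤ #(F ∩ ω)}` and all increasing `A, B` determined by `F`.  (Weaker hypothesis than `osN_threshold_nonneg_of_step`.) [this work] -/
theorem osN_threshold_nonneg_of_sqrtStep (p : ι → unitInterval)
    (hstep : ∀ (F : Finset ι) (e : ι), e ∉ F → ∀ (t : ℕ) (A B : Set (Set ι)), IsUpperSet A → IsUpperSet B →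
      DeterminedBy A (↑(insert e F) : Set ι) → DeterminedBy B (↑(insert e F) : Set ι) →
      let H : Set (Set ι) := {ω : Set ι | t + 1 ≤ ((insert e F).filter (· ∈ ω)).card}
      0 ≤
      ((prodBernoulli p).real {ω : Set ι | ω \ {e} ∈ A} - (prodBernoulli p).real ({ω : Set ι | ω \ {e} ∈ H} ∩ {ω : Set ι | ω \ {e} ∈ A})) *
          ((prodBernoulli p).real {ω : Set ι | insert e ω ∈ B} - (prodBernoulli p).real ({ω : Set ι | insert e ω ∈ H} ∩ {ω : Set ι | insert e ω ∈ B}))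
        + ((prodBernoulli p).real {ω : Set ι | insert e ω ∈ A} - (prodBernoulli p).real ({ω : Set ι | insert e ω ∈ H} ∩ {ω : Set ι | insert e ω ∈ A})) *
          ((prodBernoulli p).real {ω : Set ι | ω \ {e} ∈ B} - (prodBernoulli p).real ({ω : Set ι | ω \ {e} ∈ H} ∩ {ω : Set ι | ω \ {e} ∈ B}))
        + (1 - (prodBernoulli p).real {ω : Set ι | ω \ {e} ∈ H}) *
          (prodBernoulli p).real ({ω : Set ι | insert e ω ∈ H} ∩ {ω : Set ι | insert e ω ∈ A} ∩ {ω : Set ι | insert e ω ∈ B})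
        + (1 - (prodBernoulli p).real {ω : Set ι | insert e ω ∈ H}) *
          (prodBernoulli p).real ({ω : Set ι | ω \ {e} ∈ H} ∩ {ω : Set ι | ω \ {e} ∈ A} ∩ {ω : Set ι | ω \ {e} ∈ B})
        - ((prodBernoulli p).real {ω : Set ι | insert e ω ∈ H} - (prodBernoulli p).real {ω : Set ι | ω \ {e} ∈ H}) *
          (prodBernoulli p).real {ω : Set ι | insert e ω ∈ A} * (prodBernoulli p).real {ω : Set ι | insert e ω ∈ B}
        - (1 - (prodBernoulli p).real {ω : Set ι | insert e ω ∈ H}) *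
          ((prodBernoulli p).real {ω : Set ι | insert e ω ∈ A} * (prodBernoulli p).real {ω : Set ι | ω \ {e} ∈ B}
            + (prodBernoulli p).real {ω : Set ι | ω \ {e} ∈ A} * (prodBernoulli p).real {ω : Set ι | insert e ω ∈ B})
        + 2 * (Real.sqrt (osN p {ω : Set ι | insert e ω ∈ H} (ind {ω : Set ι | insert e ω ∈ A}) (ind {ω : Set ι | insert e ω ∈ B})) *
            Real.sqrt (osN p {ω : Set ι | ω \ {e} ∈ H} (ind {ω : Set ι | ω \ {e} ∈ A}) (ind {ω : Set ι | ω \ {e} ∈ B}))))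
    (F : Finset ι) (t : ℕ) {A B : Set (Set ι)} (hA : IsUpperSet A) (hB : IsUpperSet B)
    (hAF : DeterminedBy A (↑F : Set ι)) (hBF : DeterminedBy B (↑F : Set ι)) :
    0 ≤ osN p {ω : Set ι | t ≤ (F.filter (· ∈ ω)).card} (ind A) (ind B) := by
  induction F using Finset.induction_on generalizing t A B with
  | empty =>
    cases t with
    | zero => rw [threshold_zero, osN_ind_ind_univ]
    | succ t => rw [threshold_empty_succ, osN_ind_ind_empty]
  | insert e F heF ih =>
    cases t with
    | zero => rw [threshold_zero, osN_ind_ind_univ]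
    | succ t =>
      have hcoe : (↑(insert e F) : Set ι) \ {e} = ↑F := by
        ext i
        simp only [Set.mem_sdiff, Finset.coe_insert, Set.mem_insert_iff, Finset.mem_coe, Set.mem_singleton_iff]
        constructor
        · rintro ⟨h | h, hne⟩
          · exact absurd h hne
          · exact h
        · intro h
          exact ⟨Or.inr h, fun hie => heF (hie ▸ h)⟩
      have hA1 : DeterminedBy {ω : Set ι | insert e ω ∈ A} (↑F : Set ι) := hcoe ▸ determinedBy_section_insert hAF e
      have hA0 : DeterminedBy {ω : Set ι | ω \ {e} ∈ A} (↑F : Set ι) := hcoe ▸ determinedBy_section_sdiff hAF e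
      have hB1 : DeterminedBy {ω : Set ι | insert e ω ∈ B} (↑F : Set ι) := hcoe ▸ determinedBy_section_insert hBF e
      have hB0 : DeterminedBy {ω : Set ι | ω \ {e} ∈ B} (↑F : Set ι) := hcoe ▸ determinedBy_section_sdiff hBF e
      refine osN_ind_ind_nonneg_of_sqrtStep p _ A B e ?_ ?_ (hstep F e heF t A B hA hB hAF hBF) ?_ ?_ ?_
      · rw [section_insert_threshold heF]
        exact ih t (isUpperSet_section_insert hA e) (isUpperSet_section_insert hB e) hA1 hB1
      · rw [section_sdiff_threshold heF]
        exact ih (t + 1) (isUpperSet_section_sdiff hA e) (isUpperSet_section_sdiff hB e) hA0 hB0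
      · rw [section_insert_threshold heF, section_sdiff_threshold heF]
        exact measureReal_mono (threshold_succ_subset F t)
      · exact measureReal_mono (section_sdiff_subset_section_insert hA e)
      · exact measureReal_mono (section_sdiff_subset_section_insert hB e)

/-- **KAHN C5 / SAHI C₃ FOR EVERY THRESHOLD FIRST SLOT, CONDITIONAL ONLY ON THE SQRT-STEP INEQUALITY.**
Under the hypothesis of `osN_threshold_nonneg_of_sqrtStep` (the `(2′)` side; the `(3′)` side is the unconditional `osMp_threshold_nonneg`),
`0 ≤ E₃({ω | t ≤ #(F ∩ ω)}, A, B)` for every `F`, `t` and ALL increasing `A, B ⊆ 2^ι`. [this work] -/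
theorem sahiE3_threshold_nonneg_of_sqrtStep (p : ι → unitInterval)
    (hstep : ∀ (F : Finset ι) (e : ι), e ∉ F → ∀ (t : ℕ) (A B : Set (Set ι)), IsUpperSet A → IsUpperSet B →
      DeterminedBy A (↑(insert e F) : Set ι) → DeterminedBy B (↑(insert e F) : Set ι) →
      let H : Set (Set ι) := {ω : Set ι | t + 1 ≤ ((insert e F).filter (· ∈ ω)).card}
      0 ≤
      ((prodBernoulli p).real {ω : Set ι | ω \ {e} ∈ A} - (prodBernoulli p).real ({ω : Set ι | ω \ {e} ∈ H} ∩ {ω : Set ι | ω \ {e} ∈ A})) *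
          ((prodBernoulli p).real {ω : Set ι | insert e ω ∈ B} - (prodBernoulli p).real ({ω : Set ι | insert e ω ∈ H} ∩ {ω : Set ι | insert e ω ∈ B}))
        + ((prodBernoulli p).real {ω : Set ι | insert e ω ∈ A} - (prodBernoulli p).real ({ω : Set ι | insert e ω ∈ H} ∩ {ω : Set ι | insert e ω ∈ A})) *
          ((prodBernoulli p).real {ω : Set ι | ω \ {e} ∈ B} - (prodBernoulli p).real ({ω : Set ι | ω \ {e} ∈ H} ∩ {ω : Set ι | ω \ {e} ∈ B}))
        + (1 - (prodBernoulli p).real {ω : Set ι | ω \ {e} ∈ H}) *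
          (prodBernoulli p).real ({ω : Set ι | insert e ω ∈ H} ∩ {ω : Set ι | insert e ω ∈ A} ∩ {ω : Set ι | insert e ω ∈ B})
        + (1 - (prodBernoulli p).real {ω : Set ι | insert e ω ∈ H}) *
          (prodBernoulli p).real ({ω : Set ι | ω \ {e} ∈ H} ∩ {ω : Set ι | ω \ {e} ∈ A} ∩ {ω : Set ι | ω \ {e} ∈ B})
        - ((prodBernoulli p).real {ω : Set ι | insert e ω ∈ H} - (prodBernoulli p).real {ω : Set ι | ω \ {e} ∈ H}) *
          (prodBernoulli p).real {ω : Set ι | insert e ω ∈ A} * (prodBernoulli p).real {ω : Set ι | insert e ω ∈ B}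
        - (1 - (prodBernoulli p).real {ω : Set ι | insert e ω ∈ H}) *
          ((prodBernoulli p).real {ω : Set ι | insert e ω ∈ A} * (prodBernoulli p).real {ω : Set ι | ω \ {e} ∈ B}
            + (prodBernoulli p).real {ω : Set ι | ω \ {e} ∈ A} * (prodBernoulli p).real {ω : Set ι | insert e ω ∈ B})
        + 2 * (Real.sqrt (osN p {ω : Set ι | insert e ω ∈ H} (ind {ω : Set ι | insert e ω ∈ A}) (ind {ω : Set ι | insert e ω ∈ B})) *
            Real.sqrt (osN p {ω : Set ι | ω \ {e} ∈ H} (ind {ω : Set ι | ω \ {e} ∈ A}) (ind {ω : Set ι | ω \ {e} ∈ B}))))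
    (F : Finset ι) (t : ℕ) {A B : Set (Set ι)} (hA : IsUpperSet A) (hB : IsUpperSet B) :
    0 ≤ sahiE3 (prodBernoulli p) {ω : Set ι | t ≤ (F.filter (· ∈ ω)).card} A B :=
  sahiE3_nonneg_of_ind p (determinedBy_threshold F t)
    (fun _ _ hA' hB' hAF hBF => osMp_threshold_nonneg p F t hA' hB' hAF hBF)
    (fun _ _ hA' hB' hAF hBF => osN_threshold_nonneg_of_sqrtStep p hstep F t hA' hB' hAF hBF) hA hB

end SahiOneStep

end Summit.CriticalPhenomena.PercolationContinuityZ3.Theorems
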